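import Summits.ABC.ABC.Theorems.IneffectiveSubspaceTowerFourSubLiouvilleStubTransfer
import Summits.ABC.ABC.Theorems.IneffectiveSubspaceTowerFourSubLiouvilleStubUlGivesUBQ
import Summits.ABC.ABC.Theorems.IneffectiveSubspaceTowerFourSubLiouvilleStubHallLangGivesUL
import Summits.ABC.ABC.Theorems.IneffectiveSubspaceTowerFourSubLiouvilleStubUlGivesHallLang
import Summits.ABC.ABC.Theorems.IneffectiveSubspaceTowerFourSubLiouvilleStubAbcGivesUL

/-!
# The crux `TowerFourSubLiouville` follows from Hall–Lang for the CM family `y² = x³ + N·x` (any exponent)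

Helper (`--supports`) for the crux `Summit.ABC.ABC.Theses.IneffectiveSubspace.TowerFourSubLiouville` (stmt-ABC-1649),
line `SketchIdeator5` = idea card `Ideas/cm-hall-lang-transfer.md` (lead prover-line-stmt-ABC-1649-a1-0, 2026-08-16).

POSITION OF THE CRUX.  The crux (`∃ A < 2, TowerIneq(4, A)`) is equivalent to a uniform power saving over Liouville for
the binomial quartic family (`towerFourSubLiouville_iff_core`, p87895) and is known to follow from `ABC` (p74157), from
crux stmt-ABC-14937 (support 15070) and from the four-logarithm Lang–Waldschmidt conjecture (p111401).  This file adds the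
GENUS-ONE edge of the round-2 card and records the whole bank of the line as unconditional theorems composed BY NAME from
the four landed stub files:

* `towerFourSubLiouville_of_uniformLjunggren` : a UNIFORM LJUNGGREN bound — every integer solution of `x² − d·y⁴ = k`
  (`d` not a square, `k ≠ 0`) has `|y| ≤ C·(|d|·|k|)^K` for one pair `(K, C)` — implies the crux
  (`stub_ulGivesUBQ` p131494 then `stub_transfer` p86153; dictionary `(x, d, y, k) = (wZ², vw, Y, w(wZ⁴ − vY⁴))`);
* `towerFourSubLiouville_of_hallLang1728` : HALL–LANG for `y² = x³ + N·x` —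
  every integral point has `|x| ≤ C·|N|^κ` for one pair `(κ, C)`, all `N ≠ 0` (Lang's integral-point conjecture, 1983,
  on this `j = 1728` twist family) — implies the crux (`stub_hallLangGivesUL` p131600: the integral point `(d y², d x y)`);
* `hallLang1728_iff_uniformLjunggren` : the two targets are ONE statement (`stub_ulGivesHallLang` p131834: an integral point
  with `x > 0` is `x = d m²`, `x² + N = d n²` with `d` squarefree; the square corner `d = 1` gives `x ≤ |N|`);
* `hallLang1728_of_abc` : `ABC ⟹` Hall–Lang₁₇₂₈ (via `stub_abcGivesUL` p131908, `K = 7`), so — like the crux itself — the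
  open input of the line cannot be refuted short of `¬ABC`.

NO claim is made about Hall–Lang; all four theorems are unconditional implications.  What stays OPEN is exactly
`∃ κ C, ∀ N x y : ℤ, N ≠ 0 → y² = x³ + N x → |x| ≤ C |N|^κ` (the line's core `stub_hallLang1728`): elliptic-logarithm
bounds give `|x| ≤ exp(poly |N|)` only (`Literature.Barriers.ABC.BakerMethodBounds`), and in analytic rank one Gross–Zagier
bounds the generator's height by `N^{1/2+ε}`, the same shape (BarrierNotes-r2-k5 N1–N2 of the crux folder).
All statements are kept unfolded (no auxiliary `def`s), matching the registered stub signatures character for character.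
-/

-- `Summit.ABC.ABC` is the mandated summit-side namespace (CONVENTIONS §2); the duplicate is deliberate.
set_option linter.dupNamespace false

namespace Summit.ABC.ABC.Theorems.TowerFourSubLiouville

open scoped BigOperators
open Summit.ABC.ABC.Theses.IneffectiveSubspace

/-- **Uniform Ljunggren ⟹ crux.** A uniform-in-`(d, k)` polynomial bound for the solutions of the quartic norm equations
`x² − d y⁴ = k` (`d` non-square, `k ≠ 0`) implies `TowerFourSubLiouville` — the landed transfer `stub_transfer` fed with
the positive uniform binomial-quartic saving produced by `stub_ulGivesUBQ`. -/
theorem towerFourSubLiouville_of_uniformLjunggren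
    (hUL : ∃ K C : ℝ, 0 < C ∧ ∀ d k x y : ℤ, ¬ IsSquare d → k ≠ 0 → x ^ 2 - d * y ^ 4 = k →
      (|y| : ℝ) ≤ C * ((|d| * |k| : ℤ) : ℝ) ^ K) :
    Summit.ABC.ABC.Theses.IneffectiveSubspace.TowerFourSubLiouville :=
  stub_transfer (stub_ulGivesUBQ hUL)

/-- **Hall–Lang₁₇₂₈ ⟹ crux.** If every integral point of `y² = x³ + N x` (`N ≠ 0`) satisfies `|x| ≤ C |N|^κ` for one pair
`(κ, C)`, then `TowerFourSubLiouville` holds: Hall–Lang gives uniform Ljunggren (`stub_hallLangGivesUL`, the integral point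
`(d y², d x y)` on `W² = X³ + (dk) X`), which gives the crux (`towerFourSubLiouville_of_uniformLjunggren`). -/
theorem towerFourSubLiouville_of_hallLang1728
    (hHL : ∃ κ C : ℝ, 0 < C ∧ ∀ N x y : ℤ, N ≠ 0 → y ^ 2 = x ^ 3 + N * x → (|x| : ℝ) ≤ C * (|N| : ℝ) ^ κ) :
    Summit.ABC.ABC.Theses.IneffectiveSubspace.TowerFourSubLiouville :=
  towerFourSubLiouville_of_uniformLjunggren (stub_hallLangGivesUL hHL)

/-- **The two genus-one targets coincide.** Hall–Lang for `y² = x³ + N x` (some exponent) holds iff the uniform Ljunggren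
bound for `x² − d y⁴ = k` (some exponent) holds (`stub_hallLangGivesUL` and `stub_ulGivesHallLang`). -/
theorem hallLang1728_iff_uniformLjunggren :
    (∃ κ C : ℝ, 0 < C ∧ ∀ N x y : ℤ, N ≠ 0 → y ^ 2 = x ^ 3 + N * x → (|x| : ℝ) ≤ C * (|N| : ℝ) ^ κ) ↔
    (∃ K C : ℝ, 0 < C ∧ ∀ d k x y : ℤ, ¬ IsSquare d → k ≠ 0 → x ^ 2 - d * y ^ 4 = k →
      (|y| : ℝ) ≤ C * ((|d| * |k| : ℤ) : ℝ) ^ K) :=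
  ⟨stub_hallLangGivesUL, stub_ulGivesHallLang⟩

/-- **`ABC ⟹` Hall–Lang₁₇₂₈ (some exponent).** `ABC` gives uniform Ljunggren with `K = 7` (`stub_abcGivesUL`), hence
Hall–Lang for `y² = x³ + N x` (`stub_ulGivesHallLang`).  Consequently the open core of the line is sandwiched
`ABC ⟹ HallLang₁₇₂₈ ⟹ crux` and admits no refutation short of `¬ABC`. -/
theorem hallLang1728_of_abc (habc : _root_.ABC) :
    ∃ κ C : ℝ, 0 < C ∧ ∀ N x y : ℤ, N ≠ 0 → y ^ 2 = x ^ 3 + N * x → (|x| : ℝ) ≤ C * (|N| : ℝ) ^ κ :=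
  stub_ulGivesHallLang (stub_abcGivesUL habc)

/-- **A second route to the disprover's sandwich** `ABC ⟹ crux` (cf. `Negative.Framing.towerFourSubLiouville_of_abc`),
through the genus-one side: `ABC ⟹` uniform Ljunggren `⟹` crux. -/
theorem towerFourSubLiouville_of_abc_via_ljunggren (habc : _root_.ABC) :
    Summit.ABC.ABC.Theses.IneffectiveSubspace.TowerFourSubLiouville :=
  towerFourSubLiouville_of_uniformLjunggren (stub_abcGivesUL habc)

/-- **Stub `stub_cruxOfHallLang1728` (registered form, line `SketchIdeator5`): the conditional edge Hall–Lang₁₇₂₈ ⟹ crux**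
(= `towerFourSubLiouville_of_hallLang1728`; registered on stmt-ABC-1649 as a typed edge, not a hypothesis of the skeleton). -/
theorem stub_cruxOfHallLang1728 : (∃ κ C : ℝ, 0 < C ∧ ∀ N x y : ℤ, N ≠ 0 → y ^ 2 = x ^ 3 + N * x → (|x| : ℝ) ≤ C * (|N| : ℝ) ^ κ) → Summit.ABC.ABC.Theses.IneffectiveSubspace.TowerFourSubLiouville :=
  towerFourSubLiouville_of_hallLang1728

end Summit.ABC.ABC.Theorems.TowerFourSubLiouville
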